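import Summits.QuantumAdvantage.QuantumAdvantage.Theses.SymplecticPurity
import Literature.Computability.QuantumComplexity.BQPEqBPPIff
import Literature.Computability.QuantumComplexity.BQPContainmentsProofs
import Literature.Computability.QuantumComplexity.BQPSubsetPP
import Literature.Computability.Cryptography.ShorAssemblyLeavesProofs
import Literature.Computability.QuantumComplexity.OracleSeparationsProofs
import Literature.Computability.Complexity.ProbabilisticClassesProofs
import Literature.Computability.Cryptography.ClassBQPRelProofs

/-!
# `deq_thesis` (`FFThesis := BQP ⊆ BPP`): a kill is the summit — negative lemmas

Negative-side support file for the shared crux item `stmt-QuantumAdvantage-0242` (thesis X of the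
¬S-side routes; route decl `SymplecticPurity.FFThesis`, the same term as `Dequantize.DeqThesis`,
`PauliFlat.PPThesis`, `ShorLocallyDark.ClosureThesis`, `RectangleFree.KcThesis`, …), landed by the
standing disprover (refuter `cdisprove`). No statement of any route is asserted; every theorem is
either `H → ¬ FFThesis`, a consequence of `¬ FFThesis`, or an equivalence.

* `not_ffThesis_iff_quantumAdvantage` — **a refutation of X is, term for term, the summit**
  `QuantumAdvantage` (`∃ L ∈ BQP, L ∉ BPP`); so X is unrefutable short of solving the problem.
* `deqThesis_false_of_FACT_not_mem_BPP` — the negative lemma modulo the classical hardness of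
  factoring: `FACT ∉ BPP → ¬ X`, from the tree THEOREM `FACT_mem_BQP_holds` (Shor 1997, §5). The
  same implication typed as a NEGATIVE EDGE from the registered item `Shor.ShorThesis`
  (stmt-QuantumAdvantage-0231, `:= FACT ∉ BPP`) lives in the sibling file `DeqThesisShorEdge.lean`
  (kept separate so that this file does not depend on the route file `Theses/Shor.lean`).
  (Deliberately a plain negative lemma, not `--negative-modulo`: the hypothesis is a hardness
  conjecture, not a constructible object.)
* consequences of a kill: `¬ PSPACE ⊆ BPP`, `¬ PP ⊆ BPP`, `P ≠ PSPACE` (tree theorems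
  `BQP ⊆ PSPACE`, `BQP ⊆ PP`, `P ⊆ BPP`);
* the relativized thesis and the relativized kill are BOTH false (`not_forall_oracle_thesis`,
  `not_forall_oracle_kill`; Bernstein–Vazirani 1997 Thm. 8.10/Cor. 8.14 resp. the PSPACE-complete
  oracle — tree theorems), i.e. the catalogued barriers apply to any disproof: see the Literature
  theorems `Literature.Barriers.QuantumAdvantage.Relativization.not_relativizes_either'` and
  `Literature.Barriers.QuantumAdvantage.Algebrization.not_isAlgebrizingSeparation_bit'` (used by
  name, not re-exported here);
* `ffThesis_iff_BQPRel_zero` — oracle-freeness of the families is immaterial (`BQPRel 0 = BQP`).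

## References

* E. Bernstein, U. Vazirani, *Quantum complexity theory*, SIAM J. Comput. 26 (1997), §8,
  Thm. 8.10, Cor. 8.14. [BernsteinVazirani1997]
* P. W. Shor, SIAM J. Comput. 26 (1997), §5. [Shor1997SICOMP]
* L. Adleman, J. DeMarrais, M.-D. Huang, *Quantum computability*, SIAM J. Comput. 26 (1997),
  Thm. 6.4 (`BQP ⊆ PP`). [AdlemanDeMarraisHuang1997]
* S. Aaronson, A. Wigderson, *Algebrization*, 2008, Thm. 5.2. [AaronsonWigderson2008]
* S. Arora, B. Barak, *Computational Complexity*, CUP 2009, Thm. 3.7. [AroraBarakCC2009]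
-/

set_option linter.dupNamespace false -- D-0017: single-conjunct summit, namespace `Summit.QuantumAdvantage.QuantumAdvantage…` by design

open Computability
open Literature.Computability.Complexity Literature.Computability.Complexity.Classes
open Literature.Computability.Cryptography Literature.Computability.QuantumComplexity

namespace Summit.QuantumAdvantage.QuantumAdvantage.Theorems.DeqThesis.Negative

open Summit.QuantumAdvantage.QuantumAdvantage.Theses.SymplecticPurity (FFThesis)

/-- **A kill of the crux IS the summit**: `¬ FFThesis ↔ QuantumAdvantage` (same terms:
`¬ (BQP ⊆ BPP) ↔ ∃ L, L ∈ BQP ∧ L ∉ BPP`). [folklore] -/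
theorem not_ffThesis_iff_quantumAdvantage : ¬ FFThesis ↔ _root_.QuantumAdvantage := by
  show ¬ (BQP ⊆ BPP) ↔ ∃ L : Language Bool, L ∈ BQP ∧ L ∉ BPP
  rw [Set.not_subset]

/-- The crux is the tree's open conjecture `BQPEqBPP : BQP = BPP` (antisymmetry with the PROVED
`BPP ⊆ BQP`, `BPP_subset_BQP_holds`). [cite: BernsteinVazirani1997, Thm. 8.3] -/
theorem ffThesis_iff_bqpEqBPP : FFThesis ↔ BQPEqBPP := bqpEqBPP_iff_subset.symm

/-- `FFThesis` puts the factoring language `FACT` in `BPP` (Shor: `FACT ∈ BQP` is the tree THEOREM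
`FACT_mem_BQP_holds`). [cite: Shor1997SICOMP, §5] -/
theorem FACT_mem_BPP_of_ffThesis (h : FFThesis) : FACT ∈ BPP :=
  h (show FACT ∈ BQP from FACT_mem_BQP_holds)

/-- **Negative lemma modulo the classical hardness of factoring**: `FACT ∉ BPP → ¬ FFThesis`
(the standard evidence against X, kernel-checked down to Shor's algorithm, `FACT_mem_BQP_holds`).
`FACT ∉ BPP` is route Shor's thesis `Shor.ShorThesis` (stmt-QuantumAdvantage-0231), a hardness
conjecture, not a constructible object: plain negative lemma, no hold requested; the registered-edge
form is in `DeqThesisShorEdge.lean`. [cite: Shor1997SICOMP, §5] -/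
theorem deqThesis_false_of_FACT_not_mem_BPP (h : FACT ∉ BPP) : ¬ FFThesis :=
  fun hX => h (FACT_mem_BPP_of_ffThesis hX)

/-- Mirror: the crux puts `FACT` in `BPP`, i.e. kills route Shor's thesis: `FFThesis → ¬ (FACT ∉ BPP)`.
[cite: Shor1997SICOMP, §5] -/
theorem not_FACT_not_mem_BPP_of_deqThesis (hX : FFThesis) : ¬ (FACT ∉ BPP) :=
  fun h => h (FACT_mem_BPP_of_ffThesis hX)

/-- A kill separates `BPP` from `PSPACE` (tree theorem `BQP ⊆ PSPACE`). [cite: BernsteinVazirani1997, §8] -/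
theorem not_PSPACE_subset_BPP_of_not_ffThesis (h : ¬ FFThesis) : ¬ (PSPACE ⊆ BPP) :=
  fun hPB => h fun _ hL => hPB (BQP_subset_PSPACE_holds hL)

/-- A kill separates `BPP` from `PP` (tree theorem `BQP ⊆ PP`, Adleman–DeMarrais–Huang).
[cite: AdlemanDeMarraisHuang1997, Thm. 6.4] -/
theorem not_PP_subset_BPP_of_not_ffThesis (h : ¬ FFThesis) : ¬ (PP ⊆ BPP) :=
  fun hPB => h fun _ hL => hPB (BQP_subset_PP_holds hL)

/-- A kill proves `P ≠ PSPACE` (with the tree theorem `P ⊆ BPP`). [folklore] -/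
theorem P_ne_PSPACE_of_not_ffThesis (h : ¬ FFThesis) : Classes.P ≠ PSPACE :=
  fun e => not_PSPACE_subset_BPP_of_not_ffThesis h fun _ hL => P_subset_BPP_holds (e.symm.subset hL)

/-- The relativized THESIS is false: not every oracle has `BQP^A ⊆ BPP^A` (recursive Fourier
sampling; tree theorem `exists_oracle_BQPRel_not_subset_BPPRel_holds`).
[cite: BernsteinVazirani1997, Thm. 8.10 and Cor. 8.14] -/
theorem not_forall_oracle_thesis :
    ¬ ∀ A : Language Bool, BQPRel A ⊆ BPPRel (Oracle.ofLanguage A) := fun h => by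
  obtain ⟨B, hB⟩ := exists_oracle_BQPRel_not_subset_BPPRel_holds
  exact hB (h B)

/-- The relativized KILL is false too: not every oracle has `BQP^A ⊄ BPP^A` (PSPACE-complete
oracle; tree theorem `exists_oracle_BQPRel_subset_BPPRel_holds`).
[cite: BernsteinVazirani1997, §8 (BQP ⊆ P^{#P} ⊆ PSPACE, relativizing)] -/
theorem not_forall_oracle_kill :
    ¬ ∀ A : Language Bool, ¬ BQPRel A ⊆ BPPRel (Oracle.ofLanguage A) := fun h => by
  obtain ⟨A, hA⟩ := exists_oracle_BQPRel_subset_BPPRel_holds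
  exact h A hA

/-! NOTE (barriers, not re-exported): that neither the thesis shape `O ↦ BQP^O ⊆ BPP^O` nor the
kill shape relativizes is the Literature theorem
`Literature.Barriers.QuantumAdvantage.Relativization.not_relativizes_either'`
(`RelativizationProofs.lean`), and that the kill does not algebrize is
`Literature.Barriers.QuantumAdvantage.Algebrization.not_isAlgebrizingSeparation_bit'`
(`AlgebrizationProofs.lean`); import those files and use the names directly. -/

/-- Oracle-freeness of the families is NOT load-bearing: `FFThesis ↔ BQP^∅ ⊆ BPP` (tree theorem
`BQPRel_zero_holds : BQPRel 0 = BQP`). [cite: BernsteinVazirani1997, §8] -/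
theorem ffThesis_iff_BQPRel_zero : FFThesis ↔ BQPRel 0 ⊆ BPP := by
  have e : BQPRel 0 = BQP := BQPRel_zero_holds
  show BQP ⊆ BPP ↔ _
  rw [e]

/-- **Summary** (what a disprover of X faces): modulo `FACT ∉ BPP` the crux is false, and any
unconditional kill is the summit, separates `BPP` from `PP` and `PSPACE`, proves `P ≠ PSPACE`, and
is non-relativizing (both oracle directions fail; for the `Relativizes`/algebrization packaging see
`Literature.Barriers.QuantumAdvantage.Relativization.not_relativizes_either'` and
`Literature.Barriers.QuantumAdvantage.Algebrization.not_isAlgebrizingSeparation_bit'`). [folklore] -/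
theorem deqThesis_kill_profile :
    (FACT ∉ BPP → ¬ FFThesis) ∧
    (¬ FFThesis → _root_.QuantumAdvantage ∧ ¬ (PP ⊆ BPP) ∧ ¬ (PSPACE ⊆ BPP) ∧ Classes.P ≠ PSPACE) ∧
    (¬ ∀ A : Language Bool, BQPRel A ⊆ BPPRel (Oracle.ofLanguage A)) ∧
    (¬ ∀ A : Language Bool, ¬ BQPRel A ⊆ BPPRel (Oracle.ofLanguage A)) :=
  ⟨deqThesis_false_of_FACT_not_mem_BPP,
    fun h => ⟨not_ffThesis_iff_quantumAdvantage.1 h, not_PP_subset_BPP_of_not_ffThesis h,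
      not_PSPACE_subset_BPP_of_not_ffThesis h, P_ne_PSPACE_of_not_ffThesis h⟩,
    not_forall_oracle_thesis, not_forall_oracle_kill⟩

end Summit.QuantumAdvantage.QuantumAdvantage.Theorems.DeqThesis.Negative
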